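import Summits.Ventures.PercRepro.SixFourResidueFourPlaneLineTWDefs

/-!
# PercRepro — C-025 at `(6,4)`: the TW-100 table at `t = 4`, `13 ≤ g ≤ 32` (p3, gen 11 — §21.18.7)

The per-`g` checks `minCheckAll g` (the minimiser `m*(g,q)` of `L(g,q,m)/C(m,2)` is a minimiser, integer form) and
`twCheckAll g` (the cell inequality `w′(g,n,e,s) ≥ 0` of Lemma TW with `μ = L(m*)/C(m*,2)`, integer form) for `13 ≤ g ≤ 32`,
by `decide +kernel`; see `SixFourResidueFourPlaneLineTWDefs.lean` for the definitions and the transfer lemmas.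
-/

namespace PercRepro.SixFour

set_option maxRecDepth 20000

/-- `minCheckAll 13` (by `decide +kernel`). -/
theorem minCheckAll_13 : minCheckAll 13 := by unfold minCheckAll; decide +kernel
/-- `twCheckAll 13` (by `decide +kernel`). -/
theorem twCheckAll_13 : twCheckAll 13 := by unfold twCheckAll; decide +kernel

/-- `minCheckAll 14` (by `decide +kernel`). -/
theorem minCheckAll_14 : minCheckAll 14 := by unfold minCheckAll; decide +kernel
/-- `twCheckAll 14` (by `decide +kernel`). -/
theorem twCheckAll_14 : twCheckAll 14 := by unfold twCheckAll; decide +kernel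

/-- `minCheckAll 15` (by `decide +kernel`). -/
theorem minCheckAll_15 : minCheckAll 15 := by unfold minCheckAll; decide +kernel
/-- `twCheckAll 15` (by `decide +kernel`). -/
theorem twCheckAll_15 : twCheckAll 15 := by unfold twCheckAll; decide +kernel

/-- `minCheckAll 16` (by `decide +kernel`). -/
theorem minCheckAll_16 : minCheckAll 16 := by unfold minCheckAll; decide +kernel
/-- `twCheckAll 16` (by `decide +kernel`). -/
theorem twCheckAll_16 : twCheckAll 16 := by unfold twCheckAll; decide +kernel

/-- `minCheckAll 17` (by `decide +kernel`). -/
theorem minCheckAll_17 : minCheckAll 17 := by unfold minCheckAll; decide +kernel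
/-- `twCheckAll 17` (by `decide +kernel`). -/
theorem twCheckAll_17 : twCheckAll 17 := by unfold twCheckAll; decide +kernel

/-- `minCheckAll 18` (by `decide +kernel`). -/
theorem minCheckAll_18 : minCheckAll 18 := by unfold minCheckAll; decide +kernel
/-- `twCheckAll 18` (by `decide +kernel`). -/
theorem twCheckAll_18 : twCheckAll 18 := by unfold twCheckAll; decide +kernel

/-- `minCheckAll 19` (by `decide +kernel`). -/
theorem minCheckAll_19 : minCheckAll 19 := by unfold minCheckAll; decide +kernel
/-- `twCheckAll 19` (by `decide +kernel`). -/
theorem twCheckAll_19 : twCheckAll 19 := by unfold twCheckAll; decide +kernel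

/-- `minCheckAll 20` (by `decide +kernel`). -/
theorem minCheckAll_20 : minCheckAll 20 := by unfold minCheckAll; decide +kernel
/-- `twCheckAll 20` (by `decide +kernel`). -/
theorem twCheckAll_20 : twCheckAll 20 := by unfold twCheckAll; decide +kernel

/-- `minCheckAll 21` (by `decide +kernel`). -/
theorem minCheckAll_21 : minCheckAll 21 := by unfold minCheckAll; decide +kernel
/-- `twCheckAll 21` (by `decide +kernel`). -/
theorem twCheckAll_21 : twCheckAll 21 := by unfold twCheckAll; decide +kernel

/-- `minCheckAll 22` (by `decide +kernel`). -/
theorem minCheckAll_22 : minCheckAll 22 := by unfold minCheckAll; decide +kernel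
/-- `twCheckAll 22` (by `decide +kernel`). -/
theorem twCheckAll_22 : twCheckAll 22 := by unfold twCheckAll; decide +kernel

/-- `minCheckAll 23` (by `decide +kernel`). -/
theorem minCheckAll_23 : minCheckAll 23 := by unfold minCheckAll; decide +kernel
/-- `twCheckAll 23` (by `decide +kernel`). -/
theorem twCheckAll_23 : twCheckAll 23 := by unfold twCheckAll; decide +kernel

/-- `minCheckAll 24` (by `decide +kernel`). -/
theorem minCheckAll_24 : minCheckAll 24 := by unfold minCheckAll; decide +kernel
/-- `twCheckAll 24` (by `decide +kernel`). -/
theorem twCheckAll_24 : twCheckAll 24 := by unfold twCheckAll; decide +kernel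

/-- `minCheckAll 25` (by `decide +kernel`). -/
theorem minCheckAll_25 : minCheckAll 25 := by unfold minCheckAll; decide +kernel
/-- `twCheckAll 25` (by `decide +kernel`). -/
theorem twCheckAll_25 : twCheckAll 25 := by unfold twCheckAll; decide +kernel

/-- `minCheckAll 26` (by `decide +kernel`). -/
theorem minCheckAll_26 : minCheckAll 26 := by unfold minCheckAll; decide +kernel
/-- `twCheckAll 26` (by `decide +kernel`). -/
theorem twCheckAll_26 : twCheckAll 26 := by unfold twCheckAll; decide +kernel

/-- `minCheckAll 27` (by `decide +kernel`). -/
theorem minCheckAll_27 : minCheckAll 27 := by unfold minCheckAll; decide +kernel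
/-- `twCheckAll 27` (by `decide +kernel`). -/
theorem twCheckAll_27 : twCheckAll 27 := by unfold twCheckAll; decide +kernel

/-- `minCheckAll 28` (by `decide +kernel`). -/
theorem minCheckAll_28 : minCheckAll 28 := by unfold minCheckAll; decide +kernel
/-- `twCheckAll 28` (by `decide +kernel`). -/
theorem twCheckAll_28 : twCheckAll 28 := by unfold twCheckAll; decide +kernel

/-- `minCheckAll 29` (by `decide +kernel`). -/
theorem minCheckAll_29 : minCheckAll 29 := by unfold minCheckAll; decide +kernel
/-- `twCheckAll 29` (by `decide +kernel`). -/
theorem twCheckAll_29 : twCheckAll 29 := by unfold twCheckAll; decide +kernel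

/-- `minCheckAll 30` (by `decide +kernel`). -/
theorem minCheckAll_30 : minCheckAll 30 := by unfold minCheckAll; decide +kernel
/-- `twCheckAll 30` (by `decide +kernel`). -/
theorem twCheckAll_30 : twCheckAll 30 := by unfold twCheckAll; decide +kernel

/-- `minCheckAll 31` (by `decide +kernel`). -/
theorem minCheckAll_31 : minCheckAll 31 := by unfold minCheckAll; decide +kernel
/-- `twCheckAll 31` (by `decide +kernel`). -/
theorem twCheckAll_31 : twCheckAll 31 := by unfold twCheckAll; decide +kernel

/-- `minCheckAll 32` (by `decide +kernel`). -/
theorem minCheckAll_32 : minCheckAll 32 := by unfold minCheckAll; decide +kernel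
/-- `twCheckAll 32` (by `decide +kernel`). -/
theorem twCheckAll_32 : twCheckAll 32 := by unfold twCheckAll; decide +kernel

/-- `minCheckAll g` for every `13 ≤ g ≤ 32`. -/
theorem minCheckAll_of_rangeA {g : ℕ} (hg : 13 ≤ g) (hg' : g ≤ 32) : minCheckAll g := by
  interval_cases g
  exacts [minCheckAll_13, minCheckAll_14, minCheckAll_15, minCheckAll_16, minCheckAll_17, minCheckAll_18, minCheckAll_19, minCheckAll_20, minCheckAll_21, minCheckAll_22, minCheckAll_23, minCheckAll_24, minCheckAll_25, minCheckAll_26, minCheckAll_27, minCheckAll_28, minCheckAll_29, minCheckAll_30, minCheckAll_31, minCheckAll_32]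

/-- `twCheckAll g` for every `13 ≤ g ≤ 32`. -/
theorem twCheckAll_of_rangeA {g : ℕ} (hg : 13 ≤ g) (hg' : g ≤ 32) : twCheckAll g := by
  interval_cases g
  exacts [twCheckAll_13, twCheckAll_14, twCheckAll_15, twCheckAll_16, twCheckAll_17, twCheckAll_18, twCheckAll_19, twCheckAll_20, twCheckAll_21, twCheckAll_22, twCheckAll_23, twCheckAll_24, twCheckAll_25, twCheckAll_26, twCheckAll_27, twCheckAll_28, twCheckAll_29, twCheckAll_30, twCheckAll_31, twCheckAll_32]

end PercRepro.SixFour
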